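import Summits.CriticalPhenomena.PercolationContinuityZ3.Theorems.PercNearOneGluingNoHeavyQuantLightTwoBlobTools
import HarnessLib

/-!
# QUANT lane R8, T-DEC: the light two-blob law at its credit target, part 2 — **SUB-CASE O OF `LawDec.LightTwoBlobDEC` IS A THEOREM**
# (only atom `0` low: `c ≤ 2a`, `c ≤ 2b`; ≈ 85 % of the census), for all floors, gates and sizes

builds on p205010 (kernel theorem, internal audit signed; external expert review pending)

Support file (`--supports stmt-CriticalPhenomena-4575`), QUANT lane typer seat prim-quant-stmt (gen 22), rung R8 of `run/shared/lean/prim/quant/LADDER.md`.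
Theorems only, standard axioms, no sorries.  Part 1 is `…QuantLightTwoBlobTools` (`lightTwoBlob_decAtT_of_affordable`, `decAtT_zeroAbsorber`, `cap_ge`,
**`lightTwoBlob_capacity`**, `decAtT_zeroShare`).  Here: **`LawDec.lightTwoBlob_decAtT_caseO`** — for `0 < x < 1`, `x² < γ < x ≤ g ≤ 1`, `a, b ≥ 1`,
`j″ ≥ a + b`, target `c = b(γ−x²)/(1−x) + ag` with `c ≤ 2a`, `c ≤ 2b`: `DECAtT x c j″ (b+a) LAW2[b, γ; a, g]`.  The datum is the mixture
(`decAtT_finite_mixture` over `Fin 3`) of the three shares of atom `0` sent to the absorbers `b, a, b+a` proportionally to their capacities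
(`decAtT_zeroShare`), feasible by the capacity inequality.  Together with the affordable region this proves the typed `LightTwoBlobDEC`
(`…QuantSliceLightBelow`) except in the sub-cases "a low" / "b low" outside `x(a+b) ≤ bγ + ag` (≈ 6 % of the exact census; FOR-PROVERS-SL §4).

[this work]; DEC rules ARCH-TREES-G49 §2.2 / DEC-TAMP-G50 §3.1 (this lane).  The gluing rows served [cite: KozmaNitzan2024, Conjecture 3 (p. 15)];
product measure [cite: Grimmett1999, §1.3 p. 10].
-/

noncomputable section

namespace Summit.CriticalPhenomena.PercolationContinuityZ3.Theorems

namespace Quant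

open Finset

/-- the two-blob law `(1−u)(1−v)δ₀ + u(1−v)δ_a + (1−u)vδ_b + uvδ_{a+b}` evaluated at `h` (as in `…QuantBlobDecTwoLawParts`) -/
local notation3 "LAW2[" a ", " u ", " b ", " v ", " h "]" =>
  (1 - (u : ℝ)) * (1 - (v : ℝ)) * (if (h : ℕ) = 0 then (1 : ℝ) else 0)
    + (u : ℝ) * (1 - (v : ℝ)) * (if (h : ℕ) = (a : ℕ) then (1 : ℝ) else 0)
    + (1 - (u : ℝ)) * (v : ℝ) * (if (h : ℕ) = (b : ℕ) then (1 : ℝ) else 0)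
    + (u : ℝ) * (v : ℝ) * (if (h : ℕ) = (a : ℕ) + (b : ℕ) then (1 : ℝ) else 0)

/-- capacity (in low-mass units) of an absorber of mass `m` at height `H` for the low atom `0`, target `c`, floor `x` (as in part 1) -/
local notation3 "CAP[" x ", " c ", " H ", " m "]" =>
  (if (c : ℝ) < (H : ℝ) then (m : ℝ) * (1 - max ((c : ℝ) / (H : ℝ)) ((x : ℝ) ^ 2 + (1 - (x : ℝ)) * ((c : ℝ) / (H : ℝ))))
    / max ((c : ℝ) / (H : ℝ)) ((x : ℝ) ^ 2 + (1 - (x : ℝ)) * ((c : ℝ) / (H : ℝ))) else (0 : ℝ))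

namespace LawDec

/-- **SUB-CASE O OF `LightTwoBlobDEC`: only atom `0` is low.**  For `0 < x < 1`, `x² < γ < x ≤ g ≤ 1`, `a, b ≥ 1`, `j″ ≥ a + b` and target
`c = b(γ − x²)/(1 − x) + ag` with `c ≤ 2a` and `c ≤ 2b`, the law `LAW2[b, γ; a, g]` is DEC(j″) at target `c` on `{0..b+a}`. [this work] -/
theorem lightTwoBlob_decAtT_caseO (x γ g : ℝ) (a b j'' : ℕ) (hx0 : 0 < x) (hx1 : x < 1) (hγ0 : x ^ 2 < γ) (hγx : γ < x)
    (hxg : x ≤ g) (hg1 : g ≤ 1) (ha : 1 ≤ a) (hb : 1 ≤ b) (hj : a + b ≤ j'')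
    (h2a : (b : ℝ) * ((γ - x ^ 2) / (1 - x)) + (a : ℝ) * g ≤ 2 * (a : ℝ))
    (h2b : (b : ℝ) * ((γ - x ^ 2) / (1 - x)) + (a : ℝ) * g ≤ 2 * (b : ℝ)) :
    DECAtT x ((b : ℝ) * ((γ - x ^ 2) / (1 - x)) + (a : ℝ) * g) j'' (b + a) (fun h => LAW2[b, γ, a, g, h]) := by
  classical
  obtain ⟨c, hc⟩ : ∃ c : ℝ, c = (b : ℝ) * ((γ - x ^ 2) / (1 - x)) + (a : ℝ) * g := ⟨_, rfl⟩
  rw [← hc] at h2a h2b ⊢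
  have ha' : (1 : ℝ) ≤ a := by exact_mod_cast ha
  have hb' : (1 : ℝ) ≤ b := by exact_mod_cast hb
  have hγpos : 0 < γ := by nlinarith
  have hg0 : 0 < g := lt_of_lt_of_le hx0 hxg
  have hκ0 : 0 < (γ - x ^ 2) / (1 - x) := div_pos (by linarith) (by linarith)
  have hc0 : 0 < c := by rw [hc]; nlinarith
  -- masses and the capacity inequality
  have hm0n : 0 ≤ (1 - γ) * (1 - g) := mul_nonneg (by linarith) (by linarith)
  have hmbn : 0 ≤ γ * (1 - g) := mul_nonneg hγpos.le (by linarith)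
  have hman : 0 ≤ (1 - γ) * g := mul_nonneg (by linarith) hg0.le
  have hmabp : 0 < γ * g := mul_pos hγpos hg0
  have hS := lightTwoBlob_capacity x γ g _ c a b hx0 hx1 hγ0 hγx hxg hg1 ha' hb' rfl hc
  -- capacities are nonnegative; the one into b+a is positive
  have hcap_nn : ∀ H m : ℝ, 0 < H → 0 ≤ m → 0 ≤ CAP[x, c, H, m] ∧ (c < H → 0 < m → 0 < CAP[x, c, H, m]) := by
    intro H m hH hm
    have key : c < H → 0 < max (c / H) (x ^ 2 + (1 - x) * (c / H)) ∧ max (c / H) (x ^ 2 + (1 - x) * (c / H)) < 1 := by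
      intro hcH
      have hρ0 : 0 < c / H := div_pos hc0 hH
      have hρ1 : c / H < 1 := by rw [div_lt_one hH]; exact hcH
      refine ⟨lt_of_lt_of_le hρ0 (le_max_left _ _), max_lt hρ1 ?_⟩
      have h1x : 0 < 1 - x := by linarith
      nlinarith [mul_lt_mul_of_pos_left hρ1 h1x]
    constructor
    · split_ifs with hcH
      · exact div_nonneg (mul_nonneg hm (by linarith [(key hcH).2])) (key hcH).1.le
      · exact le_rfl
    · intro hcH hmp
      rw [if_pos hcH]
      exact div_pos (mul_pos hmp (by linarith [(key hcH).2])) (key hcH).1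
  have hHb : (0 : ℝ) < b := by linarith
  have hHa : (0 : ℝ) < a := by linarith
  have hHab : (0 : ℝ) < (b : ℝ) + a := by linarith
  have hcab : c < (b : ℝ) + a := by
    rw [hc]
    have : (γ - x ^ 2) / (1 - x) < 1 := by rw [div_lt_one (by linarith)]; nlinarith
    nlinarith [mul_lt_mul_of_pos_left this hHb]
  obtain ⟨S, hSdef⟩ : ∃ S : ℝ, S = CAP[x, c, (b : ℝ), γ * (1 - g)] + CAP[x, c, (a : ℝ), (1 - γ) * g]
      + CAP[x, c, (b : ℝ) + a, γ * g] := ⟨_, rfl⟩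
  rw [← hSdef] at hS
  have hSpos : 0 < S := by
    rw [hSdef]
    linarith [(hcap_nn _ _ hHb hmbn).1, (hcap_nn _ _ hHa hman).1, (hcap_nn _ _ hHab hmabp.le).2 hcab hmabp]
  -- the three pieces, indexed by Fin 3: heights, masses, shares of atom 0
  obtain ⟨HH, hHH⟩ : ∃ HH : Fin 3 → ℕ, HH = fun i => if i.val = 0 then b else if i.val = 1 then a else b + a := ⟨_, rfl⟩
  obtain ⟨mm, hmm⟩ : ∃ mm : Fin 3 → ℝ, mm = fun i => if i.val = 0 then γ * (1 - g) else if i.val = 1 then (1 - γ) * g else γ * g :=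
    ⟨_, rfl⟩
  obtain ⟨tt, htt⟩ : ∃ tt : Fin 3 → ℝ, tt = fun i => CAP[x, c, ((HH i : ℕ) : ℝ), mm i] / S := ⟨_, rfl⟩
  have hH0 : ((HH 0 : ℕ) : ℝ) = b := by rw [hHH]; simp
  have hH1 : ((HH 1 : ℕ) : ℝ) = a := by rw [hHH]; simp
  have hH2 : ((HH 2 : ℕ) : ℝ) = (b : ℝ) + a := by rw [hHH]; simp
  have hm0' : mm 0 = γ * (1 - g) := by rw [hmm]; simp
  have hm1' : mm 1 = (1 - γ) * g := by rw [hmm]; simp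
  have hm2' : mm 2 = γ * g := by rw [hmm]; simp
  have hHpos : ∀ i, (0 : ℝ) < (HH i : ℕ) := by
    intro i; rw [hHH]; dsimp only; split_ifs <;> push_cast <;> linarith
  have hmm_nn : ∀ i, 0 ≤ mm i := by
    intro i; rw [hmm]; dsimp only; split_ifs
    · exact hmbn
    · exact hman
    · exact hmabp.le
  have htt_nn : ∀ i, 0 ≤ tt i := fun i => by rw [htt]; exact div_nonneg (hcap_nn _ _ (hHpos i) (hmm_nn i)).1 hSpos.le
  have htt_sum : ∑ i, tt i = 1 := by
    rw [Fin.sum_univ_three, htt]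
    simp only [hH0, hH1, hH2, hm0', hm1', hm2']
    rw [← add_div, ← add_div, ← hSdef, div_self hSpos.ne']
  have hmm_sum : (1 - γ) * (1 - g) + ∑ i, mm i = 1 := by
    rw [Fin.sum_univ_three, hm0', hm1', hm2']; ring
  -- weights and piece laws
  obtain ⟨w, hw⟩ : ∃ w : Fin 3 → ℝ, w = fun i => (1 - γ) * (1 - g) * tt i + mm i := ⟨_, rfl⟩
  have hw_nn : ∀ i, 0 ≤ w i := fun i => by rw [hw]; exact add_nonneg (mul_nonneg hm0n (htt_nn i)) (hmm_nn i)
  have hw_sum : ∑ i, w i = 1 := by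
    have : ∑ i, w i = (1 - γ) * (1 - g) * ∑ i, tt i + ∑ i, mm i := by
      rw [hw, Finset.sum_add_distrib, Finset.mul_sum]
    rw [this, htt_sum, mul_one, hmm_sum]
  obtain ⟨ν, hν⟩ : ∃ ν : Fin 3 → ℕ → ℝ, ν = fun i s => if w i = 0 then (if s = HH i then (1 : ℝ) else 0)
      else ((1 - γ) * (1 - g) * tt i / w i) * (if s = 0 then (1 : ℝ) else 0)
        + (1 - (1 - γ) * (1 - g) * tt i / w i) * (if s = HH i then (1 : ℝ) else 0) := ⟨_, rfl⟩
  have hwν : ∀ i s, w i * ν i s = (1 - γ) * (1 - g) * tt i * (if s = 0 then (1 : ℝ) else 0) + mm i * (if s = HH i then (1 : ℝ) else 0) := by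
    intro i s
    rw [hν]
    by_cases hwi : w i = 0
    · simp only [if_pos hwi]
      have h1 : (1 - γ) * (1 - g) * tt i = 0 := by
        have := mul_nonneg hm0n (htt_nn i); have := hmm_nn i; rw [hw] at hwi; simp only at hwi; linarith
      have h2 : mm i = 0 := by
        have := mul_nonneg hm0n (htt_nn i); have := hmm_nn i; rw [hw] at hwi; simp only at hwi; linarith
      rw [hwi, h1, h2]; ring
    · simp only [if_neg hwi]
      have e : w i - (1 - γ) * (1 - g) * tt i = mm i := by rw [hw]; ring
      field_simp
      rw [← e]; ring
  have hmix : ∀ s, (fun h => LAW2[b, γ, a, g, h]) s = ∑ i, w i * ν i s := by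
    intro s
    simp only [hwν]
    rw [Finset.sum_add_distrib, ← Finset.sum_mul, ← Finset.mul_sum, htt_sum, mul_one, Fin.sum_univ_three, hm0', hm1', hm2']
    have e0 : (s = HH 0) ↔ (s = b) := by rw [hHH]; simp
    have e1 : (s = HH 1) ↔ (s = a) := by rw [hHH]; simp
    have e2 : (s = HH 2) ↔ (s = a + b) := by rw [hHH]; simp; omega
    simp only [e0, e1, e2]
    ring
  refine decAtT_finite_mixture x c j'' (b + a) _ w ν hw_nn hw_sum hmix fun i hwi => ?_
  -- each charged piece is the share of atom 0 sent to absorber i: `decAtT_zeroShare`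
  have hwi0 : w i ≠ 0 := ne_of_gt hwi
  have hνi : ν i = fun s => ((1 - γ) * (1 - g) * tt i / w i) * (if s = 0 then (1 : ℝ) else 0)
      + (1 - (1 - γ) * (1 - g) * tt i / w i) * (if s = HH i then (1 : ℝ) else 0) := by
    rw [hν]; funext s; simp only [if_neg hwi0]
  have htti : tt i = CAP[x, c, ((HH i : ℕ) : ℝ), mm i] / S := by rw [htt]
  have hwi' : w i = (1 - γ) * (1 - g) * tt i + mm i := by rw [hw]
  have hHle : HH i ≤ b + a := by rw [hHH]; dsimp only; split_ifs <;> omega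
  have h2H : c ≤ 2 * ((HH i : ℕ) : ℝ) := by
    rw [hHH]; dsimp only; split_ifs
    · exact h2b
    · exact h2a
    · push_cast; linarith
  have hwpos : 0 < (1 - γ) * (1 - g) * (CAP[x, c, ((HH i : ℕ) : ℝ), mm i] / S) + mm i := by
    rw [← htti, ← hwi']; exact hwi
  rw [hνi, hwi', htti]
  exact decAtT_zeroShare x c _ (mm i) S j'' (b + a) (HH i) hx0 hx1 hc0 hm0n (hmm_nn i) hSpos hS hHle (by omega) h2H
    (hHpos i) hwpos

end LawDec

end Quant

end Summit.CriticalPhenomena.PercolationContinuityZ3.Theorems
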